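import Summits.NavierStokesRegularity.NavierStokesRegularity.Theses.AxisymmetricExtremality
import Summits.NavierStokesRegularity.NavierStokesRegularity.Theorems.AxisymmetricExtremalityAxisymmetricKatoGlobalNoSwirlStratum
import Summits.NavierStokesRegularity.NavierStokesRegularity.Theorems.AxisymmetricLiouvilleBoundedSwirl
import Literature.Analysis.FluidPDE.AxisymmetricReflection
import HarnessLib

/-!
# Strategist sketch s20-g16 (crux `AxisymmetricKatoGlobal`, stmt-NavierStokesRegularity-15453)

Typed companions of the independent strategy census `STRATEGY-CENSUS-s20.md` (family `s`,
gen 16).  Nothing here is a Theorems file and no NS regularity statement is proved; every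
`theorem` below is pure logic over landed tree facts.  Contents:

* **(W₁) the weakest replacement of the crux that the route's `closes` tolerates**:
  `NoAxisymMinimalBlowupDatum` (no axisymmetric Rusin–Šverák minimal blow-up datum), with
  `closes_of_noAxisymMinimal : MinimalDatumPFold → PFoldToAxisymmetric → W₁ → NavierStokesRegularity`
  (the route's deciding theorem re-run with W₁ in place of AX) and `noAxisymMinimal_of_crux : AX → W₁`.
* **(W₂) the mirror / swirl-free bypass, PROVED**: `noMirrorSymmetricMinimalBlowupDatum` — an
  axisymmetric minimal blow-up datum cannot be equivariant under the meridian reflection `σ`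
  (such a field is swirl-free, `IsAxisymmetric.hasNoSwirl_of_reflY_eq`, and the swirl-free stratum
  of the crux is a theorem, `NoSwirlStratum.axisymmetricKatoGlobal_noSwirl_stratum`); and the
  re-glued deciding theorem `closes_of_dihedral : MinimalDatumDihedral → DihedralToMirrorAxisymmetric
  → NavierStokesRegularity` which does not mention AX at all (idea on file:
  `Ideas/dihedral-smith-bypass.md`; typed here only to certify that the bypass relocates the summit
  into the Smith crux rather than giving a strategy for THIS crux).
* **(D4) the ancient-Liouville decomposition, typed**: `NonconstantAncientLimitOfAxisymBlowup`
  (Sub₁) and the canonical conjecture leaf `AxisymmetricLiouvilleBoundedSwirl` (Sub₂ = (AX-L),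
  KNSS 2009 §5, OPEN) with the pure-logic assembly `crux_of_D4 : Sub₁ → Sub₂ → AX`; the census
  explains why Sub₁ has no mechanism (KNSS 2009, arXiv:0709.3599 p. 11: constants must be excluded
  by a scale-invariant bound, i.e. Type I, already excluded in tree).
* **(S⁺) the quantitative strengthening, typed**: `QuantitativeAxisymKato` with
  `crux_of_quantitative : S⁺ → AX`.
-/

set_option linter.dupNamespace false

noncomputable section

open MeasureTheory Set Function Filter
open scoped ENNReal
open Literature.Analysis.FluidPDE
open Literature.Analysis.FunctionSpaces (HomSobolev)

namespace Summit.NavierStokesRegularity.NavierStokesRegularity.Cruxes.AxisymmetricKatoGlobal.StrategistS20g16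

local notation "ℝ³" => EuclideanSpace ℝ (Fin 3)
local notation "ℂ³" => EuclideanSpace ℂ (Fin 3)

open Summit.NavierStokesRegularity.NavierStokesRegularity.Theses.AxisymmetricExtremality
  (MinimalDatumPFold PFoldToAxisymmetric AxisymmetricKatoGlobal)

/-! ### Clay failure at viscosity `ν` (the antecedent of `MinimalDatumPFold`, verbatim) -/

/-- Clay (A) fails at viscosity `ν`: some smooth, divergence-free, rapidly decaying datum has no
jointly smooth bounded-energy global solution (the antecedent of `MinimalDatumPFold`, verbatim). -/
def ClayFailsAt (ν : ℝ) : Prop :=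
  ∃ v₀ : ℝ³ → ℝ³, ContDiff ℝ (⊤ : ℕ∞) v₀ ∧ NSWave0.IsDivFree v₀ ∧ HasRapidSpatialDecay v₀ ∧
    ¬ ∃ (u : ℝ → ℝ³ → ℝ³) (p : ℝ → ℝ³ → ℝ), IsSmoothOnHalfSpace u ∧ IsSmoothOnHalfSpace p ∧
      IsNavierStokesSolution ν 0 v₀ u p ∧ HasBoundedEnergy u

/-! ### (W₁) the weakest intermediate the deciding theorem tolerates -/

/-- **W₁.** No axisymmetric Rusin–Šverák minimal blow-up datum exists, at any viscosity: the ONLY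
instance of the crux `AxisymmetricKatoGlobal` consumed by the route's `closes`. -/
def NoAxisymMinimalBlowupDatum : Prop :=
  ∀ ν : ℝ, 0 < ν → ∀ (u₀ : ℝ³ → ℝ³) (g : HomSobolev ℝ³ ℂ³ (1 / 2 : ℝ)),
    IsMinimalBlowupDatum ν u₀ g → IsAxisymmetric u₀ → False

/-- The route's deciding theorem re-run with W₁ in place of the crux (pure logic, same proof as
`Theses.AxisymmetricExtremality.closes`). -/
theorem closes_of_noAxisymMinimal (h₂ : MinimalDatumPFold) (h₄ : PFoldToAxisymmetric)
    (hW : NoAxisymMinimalBlowupDatum) : NavierStokesRegularity := by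
  show Literature.NS.NavierStokesExistenceSmoothR3
  intro ν hν u₀ hsm hdiv hdec
  by_contra hno
  obtain ⟨u₁, g, hmin, hax⟩ := h₄ ν hν (h₂ ν hν ⟨u₀, hsm, hdiv, hdec, hno⟩)
  exact hW ν hν u₁ g hmin (fun θ x => hax θ x)

/-- The crux implies W₁ (W₁ is formally weaker: it is AX restricted to the threshold sphere
`‖g‖ = ρ_max^pure(ν)` and negated-global data). -/
theorem noAxisymMinimal_of_crux (h : AxisymmetricKatoGlobal) : NoAxisymMinimalBlowupDatum := by
  intro ν hν u₀ g hmin hax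
  obtain ⟨hL3, hrep, hdiv, -, hnot⟩ := hmin
  exact hnot (h ν hν u₀ g hL3 hrep hdiv (fun θ x => hax θ x))

/-! ### (W₂) the mirror-symmetric (swirl-free) stratum of W₁ is a theorem -/

/-- **W₂ (PROVED).** An axisymmetric minimal blow-up datum is never equivariant under the
meridian reflection `σ (x₀, x₁, x₂) = (x₀, −x₁, x₂)`: `σ`-equivariance plus axisymmetry kills the
swirl (`IsAxisymmetric.hasNoSwirl_of_reflY_eq`), and swirl-free axisymmetric weakly
divergence-free `L³` data have global Kato solutions at every viscosity
(`NoSwirlStratum.axisymmetricKatoGlobal_noSwirl_stratum`), contradicting minimality's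
`¬ HasGlobalKatoSolution`. -/
theorem noMirrorSymmetricMinimalBlowupDatum :
    ∀ ν : ℝ, 0 < ν → ∀ (u₀ : ℝ³ → ℝ³) (g : HomSobolev ℝ³ ℂ³ (1 / 2 : ℝ)),
      IsMinimalBlowupDatum ν u₀ g → IsAxisymmetric u₀ →
        (∀ x, u₀ (reflY x) = reflY (u₀ x)) → False := by
  intro ν hν u₀ g hmin hax hσ
  obtain ⟨hL3, -, hdiv, -, hnot⟩ := hmin
  exact hnot (Theorems.AxisymmetricKatoGlobal.NoSwirlStratum.axisymmetricKatoGlobal_noSwirl_stratum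
    ν hν u₀ hL3 hdiv (fun θ x => hax θ x) (hax.hasNoSwirl_of_reflY_eq hσ))

/-- **Dihedral Smith output** (the strengthening of `MinimalDatumPFold` from cyclic `C_p` to
dihedral `D_p = C_p ⋊ ⟨σ⟩` data): if Clay fails at `ν`, then for unboundedly many `p ≥ 2` there is a
minimal blow-up datum equivariant under `R_{2π/p}` AND under the meridian reflection `σ`. -/
def MinimalDatumDihedral : Prop :=
  ∀ ν : ℝ, 0 < ν → ClayFailsAt ν → ∀ N : ℕ, ∃ p : ℕ, N ≤ p ∧ 2 ≤ p ∧
    ∃ (u₀ : ℝ³ → ℝ³) (g : HomSobolev ℝ³ ℂ³ (1 / 2 : ℝ)), IsMinimalBlowupDatum ν u₀ g ∧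
      (∀ x, u₀ (rotZ (2 * Real.pi / p) x) = rotZ (2 * Real.pi / p) (u₀ x)) ∧
      ∀ x, u₀ (reflY x) = reflY (u₀ x)

/-- **Dihedral compactness upgrade** (the `σ`-equivariant twin of the CLOSED crux
`PFoldToAxisymmetric`): dihedral minimal data for unboundedly many `p` yield an `O(2)`-equivariant
(axisymmetric AND `σ`-equivariant) minimal blow-up datum. -/
def DihedralToMirrorAxisymmetric : Prop :=
  ∀ ν : ℝ, 0 < ν →
    (∀ N : ℕ, ∃ p : ℕ, N ≤ p ∧ 2 ≤ p ∧
      ∃ (u₀ : ℝ³ → ℝ³) (g : HomSobolev ℝ³ ℂ³ (1 / 2 : ℝ)), IsMinimalBlowupDatum ν u₀ g ∧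
        (∀ x, u₀ (rotZ (2 * Real.pi / p) x) = rotZ (2 * Real.pi / p) (u₀ x)) ∧
        ∀ x, u₀ (reflY x) = reflY (u₀ x)) →
    ∃ (u₀ : ℝ³ → ℝ³) (g : HomSobolev ℝ³ ℂ³ (1 / 2 : ℝ)), IsMinimalBlowupDatum ν u₀ g ∧
      IsAxisymmetric u₀ ∧ ∀ x, u₀ (reflY x) = reflY (u₀ x)

/-- **The bypass glue (PROVED).** With the dihedral Smith output and its compactness upgrade the
summit follows WITHOUT the crux `AxisymmetricKatoGlobal` — the swirl-free stratum (W₂) suffices.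
This certifies that the bypass relocates all summit strength into `MinimalDatumDihedral` (a Smith /
moduli-space statement of the sibling crux `MinimalDatumPFold`), i.e. it is not a strategy for the
present crux. -/
theorem closes_of_dihedral (hD : MinimalDatumDihedral) (hlim : DihedralToMirrorAxisymmetric) :
    NavierStokesRegularity := by
  show Literature.NS.NavierStokesExistenceSmoothR3
  intro ν hν u₀ hsm hdiv hdec
  by_contra hno
  obtain ⟨u₁, g, hmin, hax, hσ⟩ := hlim ν hν (hD ν hν ⟨u₀, hsm, hdiv, hdec, hno⟩)
  exact noMirrorSymmetricMinimalBlowupDatum ν hν u₁ g hmin hax hσ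

/-! ### (D4) the ancient-Liouville decomposition, typed -/

/-- **Sub₁ of D4.** An axisymmetric critical datum WITHOUT a global Kato solution generates a
bounded ancient mild solution (`ν = 1`) with measurable axisymmetric slices and bounded swirl which
is NOT slice-wise a.e. constant.  (KNSS's blow-up procedure, arXiv:0709.3599 Prop. 6.1, gives a
non-zero bounded ancient solution; "non-constant" needs a scale-invariant bound — Type I — and is
exactly what a Type II axisymmetric blow-up does not supply: census §Decomposition.) -/
def NonconstantAncientLimitOfAxisymBlowup : Prop :=
  ∀ ν : ℝ, 0 < ν → ∀ (u₀ : ℝ³ → ℝ³) (g : HomSobolev ℝ³ ℂ³ (1 / 2 : ℝ)),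
    MemLp u₀ 3 volume → g.Represents (Literature.Analysis.FunctionSpaces.EuclideanSpace.complexify ∘ u₀) →
    IsWeaklyDivFree u₀ → IsAxisymmetric u₀ → ¬ HasGlobalKatoSolution ν u₀ →
      ∃ U : ℝ → ℝ³ → ℝ³, IsBoundedAncientMildSolution 1 U ∧
        (∀ t < 0, AEStronglyMeasurable (U t) volume) ∧ (∀ t < 0, IsAxisymmetric (U t)) ∧
        (∃ C : ℝ, ∀ t < 0, ∀ x, |swirl (U t) x| ≤ C) ∧
        ∃ t < 0, ¬ ∃ b : ℝ³, U t =ᵐ[volume] fun _ => b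

/-- **Assembly of D4 (pure logic).** Sub₁ and the KNSS Liouville conjecture for axisymmetric
bounded ancient solutions with bounded swirl (canonical conjecture leaf
`AxisymmetricLiouvilleBoundedSwirl`, OPEN) give the crux. -/
theorem crux_of_D4 (h₁ : NonconstantAncientLimitOfAxisymBlowup)
    (h₂ : Summit.NavierStokesRegularity.NavierStokesRegularity.AxisymmetricLiouvilleBoundedSwirl) :
    AxisymmetricKatoGlobal := by
  intro ν hν u₀ g hL3 hrep hdiv hax
  by_contra hno
  obtain ⟨U, hU, hmeas, haxU, hsw, t, ht, hnc⟩ :=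
    h₁ ν hν u₀ g hL3 hrep hdiv (fun θ x => hax θ x) hno
  exact hnc (h₂ U hU hmeas haxU hsw t ht)

/-! ### (S⁺) the quantitative strengthening, typed -/

/-- **S⁺ (quantitative AX).** There is a profile `F`, finite on finite arguments, such that every
axisymmetric critical datum has a global Kato solution whose `L³` norm stays below
`F(‖g‖_{Ḣ^{1/2}} / ν)` for all `t ≥ 0`. -/
def QuantitativeAxisymKato : Prop :=
  ∃ F : ℝ≥0∞ → ℝ≥0∞, (∀ a, a < ⊤ → F a < ⊤) ∧
    ∀ ν : ℝ, 0 < ν → ∀ (u₀ : ℝ³ → ℝ³) (g : HomSobolev ℝ³ ℂ³ (1 / 2 : ℝ)),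
      MemLp u₀ 3 volume → g.Represents (Literature.Analysis.FunctionSpaces.EuclideanSpace.complexify ∘ u₀) →
      IsWeaklyDivFree u₀ → IsAxisymmetric u₀ →
        ∃ u : ℝ → ℝ³ → ℝ³, IsGlobalMildSolution ν 0 u₀ u ∧ ContinuousInLpOn (Ici 0) 3 u ∧ u 0 = u₀ ∧
          AEStronglyMeasurable (uncurry u) (volume.restrict (Ioi 0 ×ˢ univ)) ∧
          ∀ t, 0 ≤ t → eLpNorm (u t) 3 volume ≤ F (‖g‖ₑ / ENNReal.ofReal ν)

/-- S⁺ implies the crux (forget the bound). -/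
theorem crux_of_quantitative (h : QuantitativeAxisymKato) : AxisymmetricKatoGlobal := by
  obtain ⟨F, -, hF⟩ := h
  intro ν hν u₀ g hL3 hrep hdiv hax
  obtain ⟨u, hglob, hcont, h0, hmeas, -⟩ := hF ν hν u₀ g hL3 hrep hdiv (fun θ x => hax θ x)
  exact ⟨u, hglob, hcont, h0, hmeas⟩

end Summit.NavierStokesRegularity.NavierStokesRegularity.Cruxes.AxisymmetricKatoGlobal.StrategistS20g16

end
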